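import Mathlib.Analysis.SpecialFunctions.Pow.Real
import Mathlib.Analysis.SpecialFunctions.Log.Basic
import Literature.Barriers.Parity.LeastPrimeValue
import Literature.Barriers.Parity.LeastPrimeValueBarrierProofs
import HarnessLib

/-!
# Proof of `Literature.Barriers.Parity.McCurley1986_uniform` (McCurley 1986, Theorem 2 as printed)

Third companion ("Proofs") file of `Literature/Barriers/Parity/LeastPrimeValue.lean` (the first,
`LeastPrimeValueProofs.lean`, discharges `McCurley1986_noSmallPrimeValues`; the second,
`LeastPrimeValueBarrierProofs.lean`, discharges `LeastPrimeValueBarrier` = Theorem 3). It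
DISCHARGES the named fact `Literature.Barriers.Parity.McCurley1986_uniform` — K. S. McCurley,
*The smallest prime value of `xⁿ + a`*, Can. J. Math. 38 (1986) 925–936, Theorem 2 (p. 926),
unconditional sentence, verbatim: "There exists a positive absolute constant `C₃` such that for
every integer `n ≥ 2`, and `u ≥ 2`, there exists a positive integer `a` with
`0 < a < exp[exp(u^{1/d(n)} n^{C₃})]` such that `xⁿ + a` is irreducible over the integers and
`xⁿ + a` is composite for all integers `x` with `0 ≤ x ≤ u`" (`d(n)` = number of divisors of `n`).

## The proof given here, and a remark on the strength of the printed statement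

The fact is proved with `C₃ = 3` by the EXPLICIT ELEMENTARY WITNESS

  `a = 2 + 2 ∏_{x=0}^{u} (xⁿ + 2)`:

* `a ≡ 2 (mod 4)` (the product is even, its factor at `x = 0` being `2`), so `xⁿ + a` is
  Eisenstein at `2`, hence irreducible (`McCurleyThm3.irreducible_X_pow_add_C_of_eisenstein` of
  the second companion file — McCurley's own device "`a ≡ q (mod q²)`", §3 p. 931, with `q = 2`);
* for `0 ≤ x ≤ u`, `xⁿ + 2` is a divisor of `xⁿ + a = (xⁿ + 2) + 2∏` strictly between `1` and
  `xⁿ + a`, so `xⁿ + a` is composite (`IsComposite.of_dvd`);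
* `a ≤ u^{3nu}` (`McCurleyThm2.two_add_two_mul_prod_le_pow`), and
  `u^{1/d(n)} n³ = e^{(log u)/d(n)} n³ ≥ (1 + (log u)/d(n)) n³ ≥ n³ + n² log u` because `d(n) ≤ n`,
  whence `exp(u^{1/d(n)} n³) ≥ e^{n³} u^{n²} ≥ (1 + n³) u² > 3nu² ≥ 3nu log u = log(u^{3nu})`
  (`McCurleyThm2.pow_lt_exp_exp_rpow`), i.e. `a < exp[exp(u^{1/d(n)} n³)]`.

REMARK (scope of what is discharged). As printed — a doubly exponential bound with an UNSPECIFIED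
positive absolute constant `C₃` — the unconditional sentence of Theorem 2 is therefore already a
consequence of the elementary construction the paper itself alludes to just before stating it ("It
is easy to prove that for any fixed `n` and `u`, there exists a positive integer `a` such that
`xⁿ + a` is irreducible over the integers and `xⁿ + a` is composite for all integers `x` with
`0 ≤ x ≤ u`. The following result gives an estimate for the least value of `a` for which this is
true", p. 926): any `a ≤ exp(O(nu log u))` has `log₂ a ≤ u^{1/d(n)} n^{C₃}` once `C₃ ≥ 3`. This is
NOT McCurley's proof. His argument (§3, pp. 931–932: `w = exp{(1+u)^{1/d(n)} n^{C₁₆}}`, `a` chosen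
modulo `Q = q² ∏_{p<w} p` with `a ≡ q (mod q²)` and `a < 2Q < exp(2w)`, the numbers `0 ≤ m ≤ u`
being covered by congruences `mⁿ + a ≡ 0 (mod p_k)` greedily, each prime removing a proportion
`≥ 1/(1 + (p_k − 1)/(p_k − 1, n))` of the survivors, counted through Lemma 5 and Norton's and
Bombieri's estimates for primes `≡ 1 (mod d)`, `d ∣ n`) is what also yields the CONDITIONAL
sentence of Theorem 2 — "If there do not exist any Siegel zeros … `0 < a < exp[exp(C₄ u^{1/d(n)} log n)]`"
(pp. 926–927) — which is not implied by the elementary witness (for `d(n) ≥ log u` it bounds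
`log₂ a` by `O(log n)`, against `≍ log u + log n` for any `a` of size `exp(O(nu log u))`) and which
is neither transcribed in the tree nor proved here. Consequently the companion fact
`McCurley1986_uniform`, as a constraint on effective Bouniakowsky bounds, carries no force beyond
the elementary one; the degree-uniform content of McCurley's Theorem 2 lives in its conditional
half.

## References

* K. S. McCurley, *The smallest prime value of `xⁿ + a`*, Can. J. Math. 38 (1986) 925–936,
  Theorem 2 (p. 926; conditional sentence pp. 926–927), the remark preceding it (p. 926), and §3
  (pp. 931–932) [cite: McCurley1986SmallestPrimeValue, Theorem 2 (p. 926) and §3 (pp. 931–932)] —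
  read on the page (doi:10.4153/CJM-1986-045-9).
-/

noncomputable section

open Finset Polynomial

namespace Literature.Barriers.Parity

/-- A natural number with a divisor strictly between `1` and itself is composite. [folklore] -/
theorem IsComposite.of_dvd {m d : ℕ} (hd : 1 < d) (hdm : d ∣ m) (hlt : d < m) :
    IsComposite m := by
  refine ⟨lt_trans hd hlt, fun hp => ?_⟩
  rcases hp.eq_one_or_self_of_dvd d hdm with h | h <;> omega

namespace McCurleyThm2

/-- `d(n) ≤ n` for the tree's `numDivisors`: definitionally Mathlib's `Nat.card_divisors_le_self`,
which is to be used directly; this restatement is deprecated (dedup-00599). [folklore] -/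
@[deprecated Nat.card_divisors_le_self (since := "2026-08-15")]
theorem numDivisors_le_self (n : ℕ) : numDivisors n ≤ n := Nat.card_divisors_le_self n

/-- **Size of the elementary witness**: `2 + 2 ∏_{x=0}^{u} (xⁿ + 2) ≤ u^{3nu}` for `n, u ≥ 2`
(each factor is `≤ uⁿ + 2 ≤ uⁿ⁺¹`, there are `u + 1` of them, and `(n+1)(u+1) + 2 ≤ 3nu`).
[folklore] -/
theorem two_add_two_mul_prod_le_pow {n u : ℕ} (hn : 2 ≤ n) (hu : 2 ≤ u) :
    2 + 2 * ∏ x ∈ range (u + 1), (x ^ n + 2) ≤ u ^ (3 * n * u) := by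
  have hfac : ∀ x ∈ range (u + 1), x ^ n + 2 ≤ u ^ (n + 1) := by
    intro x hx
    have hxu : x ≤ u := Nat.lt_succ_iff.mp (mem_range.mp hx)
    have h1 : x ^ n ≤ u ^ n := Nat.pow_le_pow_left hxu n
    have h2 : 2 ≤ u ^ n := le_trans hu (Nat.le_self_pow (by omega) u)
    calc x ^ n + 2 ≤ u ^ n + u ^ n := add_le_add h1 h2
      _ = u ^ n * 2 := by ring
      _ ≤ u ^ n * u := Nat.mul_le_mul_left _ hu
      _ = u ^ (n + 1) := by ring
  have hP : ∏ x ∈ range (u + 1), (x ^ n + 2) ≤ (u ^ (n + 1)) ^ (u + 1) := by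
    calc ∏ x ∈ range (u + 1), (x ^ n + 2) ≤ (u ^ (n + 1)) ^ #(range (u + 1)) :=
          prod_le_pow_card _ _ _ hfac
      _ = (u ^ (n + 1)) ^ (u + 1) := by rw [card_range]
  have hexp : (n + 1) * (u + 1) + 2 ≤ 3 * n * u := by nlinarith
  have hu0 : 0 < u := by omega
  have hone : 1 ≤ (u ^ (n + 1)) ^ (u + 1) := Nat.one_le_pow _ _ (by positivity)
  have hu4 : 4 ≤ u ^ 2 := by nlinarith
  calc 2 + 2 * ∏ x ∈ range (u + 1), (x ^ n + 2) ≤ 2 + 2 * (u ^ (n + 1)) ^ (u + 1) := by omega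
    _ ≤ 4 * (u ^ (n + 1)) ^ (u + 1) := by omega
    _ ≤ u ^ 2 * (u ^ (n + 1)) ^ (u + 1) := Nat.mul_le_mul_right _ hu4
    _ = u ^ ((n + 1) * (u + 1) + 2) := by rw [← pow_mul]; ring
    _ ≤ u ^ (3 * n * u) := Nat.pow_le_pow_right hu0 hexp

/-- **The real-variable comparison behind Theorem 2 as printed**: for `n, u ≥ 2` and
`1 ≤ d ≤ n`, `u^{3nu} < exp(exp(u^{1/d} n³))`. Indeed `u^{1/d} = e^{(log u)/d} ≥ 1 + (log u)/d`,
so `u^{1/d} n³ ≥ n³ + n² log u`, and `exp(n³ + n² log u) = e^{n³} u^{n²} ≥ (1 + n³) u² > 3nu²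
≥ 3nu log u`. [folklore] -/
theorem pow_lt_exp_exp_rpow {n u d : ℕ} (hn : 2 ≤ n) (hu : 2 ≤ u) (hd1 : 1 ≤ d) (hdn : d ≤ n) :
    (u : ℝ) ^ (3 * n * u) <
      Real.exp (Real.exp ((u : ℝ) ^ (1 / (d : ℝ)) * (n : ℝ) ^ (3 : ℝ))) := by
  have hu0 : (0 : ℝ) < u := by exact_mod_cast (by omega : 0 < u)
  have hu1 : (1 : ℝ) < u := by exact_mod_cast (by omega : 1 < u)
  have hn2 : (2 : ℝ) ≤ n := by exact_mod_cast hn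
  have hd0 : (0 : ℝ) < d := by exact_mod_cast (by omega : 0 < d)
  have hdn' : (d : ℝ) ≤ n := by exact_mod_cast hdn
  have hL0 : 0 < Real.log u := Real.log_pos hu1
  have hLu : Real.log u ≤ u := (Real.log_le_sub_one_of_pos hu0).trans (by linarith)
  -- the left side as an exponential
  have hlhs : (u : ℝ) ^ (3 * n * u) = Real.exp (((3 * n * u : ℕ) : ℝ) * Real.log u) := by
    rw [Real.exp_nat_mul, Real.exp_log hu0]
  rw [hlhs, Real.exp_lt_exp]
  -- `n ^ (3 : ℝ) = n ^ 3`
  have hn3 : (n : ℝ) ^ (3 : ℝ) = (n : ℝ) ^ (3 : ℕ) := by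
    rw [← Real.rpow_natCast]
    norm_num
  rw [hn3]
  -- `u ^ (1/d) = exp (log u / d) ≥ 1 + log u / d`
  have hrpow : 1 + Real.log u / d ≤ (u : ℝ) ^ (1 / (d : ℝ)) := by
    rw [Real.rpow_def_of_pos hu0]
    have heq : Real.log (u : ℝ) * (1 / (d : ℝ)) = Real.log u / d := by ring
    rw [heq]
    linarith [Real.add_one_le_exp (Real.log u / d)]
  -- lower bound for the exponent
  have hE : (n : ℝ) ^ 3 + Real.log u * (n : ℝ) ^ 2 ≤ (u : ℝ) ^ (1 / (d : ℝ)) * (n : ℝ) ^ 3 := by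
    have hn0 : (0 : ℝ) ≤ (n : ℝ) ^ 3 := by positivity
    have hkey : Real.log u * (n : ℝ) ^ 2 ≤ Real.log u / d * (n : ℝ) ^ 3 := by
      rw [div_mul_eq_mul_div, le_div_iff₀ hd0]
      have : (n : ℝ) ^ 2 * d ≤ (n : ℝ) ^ 3 := by nlinarith
      nlinarith
    calc (n : ℝ) ^ 3 + Real.log u * (n : ℝ) ^ 2
        ≤ (n : ℝ) ^ 3 + Real.log u / d * (n : ℝ) ^ 3 := by linarith
      _ = (1 + Real.log u / d) * (n : ℝ) ^ 3 := by ring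
      _ ≤ (u : ℝ) ^ (1 / (d : ℝ)) * (n : ℝ) ^ 3 := mul_le_mul_of_nonneg_right hrpow hn0
  -- `exp (2 log u) = u²`
  have h2L : Real.exp (2 * Real.log u) = (u : ℝ) ^ 2 := by
    rw [show (2 : ℝ) * Real.log u = ((2 : ℕ) : ℝ) * Real.log u by norm_num, Real.exp_nat_mul,
      Real.exp_log hu0]
  have h3n : 3 * (n : ℝ) < 1 + (n : ℝ) ^ 3 := by nlinarith [sq_nonneg ((n : ℝ) - 2)]
  have hu2 : (0 : ℝ) < (u : ℝ) ^ 2 := by positivity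
  have hn22 : (2 : ℝ) ≤ (n : ℝ) ^ 2 := by nlinarith
  calc ((3 * n * u : ℕ) : ℝ) * Real.log u ≤ 3 * n * u * u := by
        push_cast
        exact mul_le_mul_of_nonneg_left hLu (by positivity)
    _ = 3 * (n : ℝ) * (u : ℝ) ^ 2 := by ring
    _ < (1 + (n : ℝ) ^ 3) * (u : ℝ) ^ 2 := mul_lt_mul_of_pos_right h3n hu2
    _ ≤ Real.exp ((n : ℝ) ^ 3) * Real.exp (2 * Real.log u) := by
        rw [h2L]
        gcongr
        linarith [Real.add_one_le_exp ((n : ℝ) ^ 3)]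
    _ ≤ Real.exp ((n : ℝ) ^ 3) * Real.exp (Real.log u * (n : ℝ) ^ 2) := by
        refine mul_le_mul_of_nonneg_left (Real.exp_le_exp.mpr ?_) (Real.exp_pos _).le
        nlinarith [mul_le_mul_of_nonneg_left hn22 hL0.le]
    _ = Real.exp ((n : ℝ) ^ 3 + Real.log u * (n : ℝ) ^ 2) := (Real.exp_add _ _).symm
    _ ≤ Real.exp ((u : ℝ) ^ (1 / (d : ℝ)) * (n : ℝ) ^ 3) := Real.exp_le_exp.mpr hE

end McCurleyThm2

open McCurleyThm2

/-! ### The theorem -/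

/-- **McCurley 1986, Theorem 2 (unconditional sentence, as printed), PROVED** — discharging the
named fact `McCurley1986_uniform`: there is an absolute constant `C₃ > 0` (here `C₃ = 3`) such
that for all integers `n ≥ 2` and `u ≥ 2` some positive integer
`a < exp[exp(u^{1/d(n)} n^{C₃})]` makes `xⁿ + a` irreducible over `ℤ` and `xⁿ + a` composite for
every integer `0 ≤ x ≤ u`. The witness is the elementary `a = 2 + 2∏_{x=0}^{u} (xⁿ + 2)`
(`a ≡ 2 (mod 4)`: Eisenstein at `2`; `xⁿ + 2` a proper divisor of `xⁿ + a` for `x ≤ u`;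
`a ≤ u^{3nu} < exp[exp(u^{1/d(n)} n³)]` as `d(n) ≤ n`) — see the module docstring for why the
sentence as printed (unspecified `C₃`) asks no more than this, and for what McCurley's §3 argument
gives in addition (the Siegel-zero-conditional bound `exp[exp(C₄ u^{1/d(n)} log n)]`, not
transcribed). [cite: McCurley1986SmallestPrimeValue, Theorem 2 (p. 926) and §3 (pp. 931–932)] -/
theorem McCurley1986_uniform_holds : McCurley1986_uniform := by
  refine ⟨3, by norm_num, fun n hn u hu => ?_⟩
  have hn0 : n ≠ 0 := by omega
  -- the product `P = ∏_{x ≤ u} (xⁿ + 2)`: positive and even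
  set P : ℕ := ∏ x ∈ range (u + 1), (x ^ n + 2) with hP
  have hPpos : 0 < P := prod_pos fun x _ => by positivity
  have h2P : 2 ∣ P := by
    have h := dvd_prod_of_mem (fun x : ℕ => x ^ n + 2) (mem_range.mpr (Nat.succ_pos u))
    simpa [zero_pow hn0] using h
  refine ⟨2 + 2 * P, by omega, ?_, ?_, ?_⟩
  · -- the size bound `a ≤ u^{3nu} < exp(exp(u^{1/d(n)} n³))`
    have hsize : 2 + 2 * P ≤ u ^ (3 * n * u) := two_add_two_mul_prod_le_pow hn hu
    calc ((2 + 2 * P : ℕ) : ℝ) ≤ ((u ^ (3 * n * u) : ℕ) : ℝ) := by exact_mod_cast hsize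
      _ = (u : ℝ) ^ (3 * n * u) := by push_cast; ring
      _ < _ :=
        pow_lt_exp_exp_rpow hn hu (one_le_numDivisors (by omega)) (Nat.card_divisors_le_self n)
  · -- irreducibility: `a ≡ 2 (mod 4)`, Eisenstein at `2`
    have h2 : 2 ∣ 2 + 2 * P := ⟨1 + P, by ring⟩
    have h4 : ¬ 2 ^ 2 ∣ 2 + 2 * P := by
      obtain ⟨P', hP'⟩ := h2P
      omega
    exact McCurleyThm3.irreducible_X_pow_add_C_of_eisenstein (by omega) Nat.prime_two h2 h4
  · -- compositeness: `xⁿ + 2` is a proper divisor of `xⁿ + a` for `x ≤ u`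
    intro x hx
    have hdvd : x ^ n + 2 ∣ P :=
      dvd_prod_of_mem (fun x : ℕ => x ^ n + 2) (mem_range.mpr (Nat.lt_succ_of_le hx))
    refine IsComposite.of_dvd (d := x ^ n + 2) (by omega) ?_ (by omega)
    have : x ^ n + (2 + 2 * P) = (x ^ n + 2) + 2 * P := by ring
    rw [this]
    exact dvd_add (dvd_refl _) (dvd_mul_of_dvd_right hdvd 2)

end Literature.Barriers.Parity
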